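import Mathlib
import HarnessLib
import Summits.NavierStokesRegularity.NavierStokesRegularity.Theorems.UnthreadedRigidityDoorUnthreadedRigidityHornPressureDefs
import Summits.NavierStokesRegularity.NavierStokesRegularity.Theorems.UnthreadedRigidityDoorUnthreadedRigidityProfileHornMoments
import Summits.NavierStokesRegularity.NavierStokesRegularity.Theorems.UnthreadedRigidityDoorUnthreadedRigidityVirialHornShellFields

/-!
# Route `UnthreadedRigidityDoor`, item `UnthreadedRigidity` (W2, stmt-NavierStokesRegularity-27585) — LINE g10-2 «PROFILE HORN»,
# BRIDGE PH (L-part `ThreadingJets.HornSliceIdentityTwo`), file 4: THE THREE SOURCE CHANNELS — smoothness, r-picture, decay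

Prover file (W2 Lean hand ns-crc-p1 g9, by lineage; `--supports stmt-NavierStokesRegularity-27585 --as helper`).  For a horn-admissible profile
(`H(r) = h(r²)`, `h` smooth, `r⁵|H|, r⁶|H′|, r⁷|H″| ≤ C` on `[1,∞)` — the clauses of `ProfileHorn.HornAdmissible`) the channels
`chanZero h`, `chanTwo h`, `chanFour h` of `…HornPressureDefs` (p717811) are smooth (`contDiff_chan*`), agree with g7's `aTwo H`, `aFour H` at
`σ = ρ²` (`chanTwo_sq_eq`, `chanFour_sq_eq`; `chanZero_sq_eq` gives the monopole in terms of `H, H′, H″`), and DECAY at the rates the radial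
layer asks for (`|g(σ)| ≤ K/σ^{L+2}`): `abs_chanZero_le` (`(432/5)C²/σ²`), `abs_chanTwo_le` (`(576/7)C²/σ⁴`), `abs_chanFour_le` (`152C²/σ⁶`), from the
sharp pointwise bounds `abs_aTwo_le` (`(576/7)C²/ρ¹²`), `abs_aFour_le` (`152C²/ρ¹⁴`) and the monopole squeeze `abs_bracket_zero_le` (g7's
`abs_bracket_two_le` / `abs_bracket_four_le` reused).

HONEST LABEL: one-dimensional estimates for the L-part of ONE bridge of a RUNG line about SPECIAL (separable `l = 2`) slice data;
`UnthreadedRigidity` (27585), W2 and NS regularity remain OPEN; nothing here is a statement about the Navier–Stokes equations.  0 kit.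
-/

-- the summit and its single sub-problem share the name (CONVENTIONS §1), as in every Theorems file
set_option linter.dupNamespace false

noncomputable section

namespace Summit.NavierStokesRegularity.NavierStokesRegularity.Theorems.UnthreadedRigidity.HornPressure

open scoped Topology ContDiff
open Filter Set
open Summit.NavierStokesRegularity.NavierStokesRegularity.Theorems.UnthreadedRigidity.ProfileHorn
  (aTwo aFour aTwo_eq aFour_eq deriv_profile deriv_deriv_profile differentiable_of_smooth differentiable_deriv_of_smooth
   decay_const_nonneg abs_bracket_two_le abs_bracket_four_le abs_pow_mul_le)
open Summit.NavierStokesRegularity.NavierStokesRegularity.Theorems.UnthreadedRigidity.VirialHorn (contDiff_deriv_of_contDiff_top)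

variable {h H : ℝ → ℝ} {C : ℝ}

/-! ## The channels are smooth -/

/-- `chanTwo h` is smooth. -/
theorem contDiff_chanTwo (hh : ContDiff ℝ ∞ h) : ContDiff ℝ ∞ (chanTwo h) := by
  have h1 := contDiff_deriv_of_contDiff_top hh
  have h2 := contDiff_deriv_of_contDiff_top h1
  unfold chanTwo
  fun_prop

/-- `chanFour h` is smooth. -/
theorem contDiff_chanFour (hh : ContDiff ℝ ∞ h) : ContDiff ℝ ∞ (chanFour h) := by
  have h1 := contDiff_deriv_of_contDiff_top hh
  have h2 := contDiff_deriv_of_contDiff_top h1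
  unfold chanFour
  fun_prop

/-- `chanZero h` is smooth. -/
theorem contDiff_chanZero (hh : ContDiff ℝ ∞ h) : ContDiff ℝ ∞ (chanZero h) := by
  have h1 := contDiff_deriv_of_contDiff_top hh
  have h2 := contDiff_deriv_of_contDiff_top h1
  unfold chanZero
  fun_prop

/-! ## The channels in the variable `r` (`σ = r²`) -/

/-- `ã₂(ρ²) = aTwo H ρ` (`ρ > 0`). -/
theorem chanTwo_sq_eq (hh : ContDiff ℝ ∞ h) (hH : ∀ r, 0 ≤ r → H r = h (r ^ 2)) {ρ : ℝ} (hρ : 0 < ρ) :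
    chanTwo h (ρ ^ 2) = aTwo H ρ := by
  rw [aTwo_eq (differentiable_of_smooth hh) (differentiable_deriv_of_smooth hh) hH hρ, chanTwo]
  ring

/-- `ã₄(ρ²) = aFour H ρ` (`ρ > 0`). -/
theorem chanFour_sq_eq (hh : ContDiff ℝ ∞ h) (hH : ∀ r, 0 ≤ r → H r = h (r ^ 2)) {ρ : ℝ} (hρ : 0 < ρ) :
    chanFour h (ρ ^ 2) = aFour H ρ := by
  rw [aFour_eq (differentiable_of_smooth hh) (differentiable_deriv_of_smooth hh) hH hρ, chanFour]

/-- `ã₀(ρ²)` in terms of `H, H′, H″` at `ρ > 0`: `36H² + (216/5)ρHH′ + (4/5)ρ²H′² + (24/5)ρ²HH″ − (8/5)ρ³H′H″`. -/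
theorem chanZero_sq_eq (hh : ContDiff ℝ ∞ h) (hH : ∀ r, 0 ≤ r → H r = h (r ^ 2)) {ρ : ℝ} (hρ : 0 < ρ) :
    chanZero h (ρ ^ 2) = 36 * H ρ ^ 2 + 216 / 5 * ρ * H ρ * deriv H ρ + 4 / 5 * ρ ^ 2 * deriv H ρ ^ 2
      + 24 / 5 * ρ ^ 2 * H ρ * deriv (deriv H) ρ - 8 / 5 * ρ ^ 3 * deriv H ρ * deriv (deriv H) ρ := by
  rw [deriv_deriv_profile (differentiable_of_smooth hh) (differentiable_deriv_of_smooth hh) hH hρ,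
    deriv_profile (differentiable_of_smooth hh) hH hρ, hH ρ hρ.le, chanZero]
  ring

/-! ## Decay of the channels from `HornAdmissible` decay (`r⁵|H|, r⁶|H′|, r⁷|H″| ≤ C` on `[1,∞)`) -/

/-- `|a₂(ρ)| ≤ (576/7) C²/ρ¹²` for `ρ ≥ 1`. -/
theorem abs_aTwo_le (hC : ∀ r, 1 ≤ r → r ^ 5 * |H r| ≤ C ∧ r ^ 6 * |deriv H r| ≤ C ∧ r ^ 7 * |deriv (deriv H) r| ≤ C)
    {ρ : ℝ} (hρ : 1 ≤ ρ) : |aTwo H ρ| ≤ 576 / 7 * C ^ 2 / ρ ^ 12 := by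
  have hρ0 : 0 < ρ := lt_of_lt_of_le one_pos hρ
  obtain ⟨h5, h6, h7⟩ := hC ρ hρ
  have hX := abs_pow_mul_le hρ0.le h5
  have hY := abs_pow_mul_le hρ0.le h6
  have hZ := abs_pow_mul_le hρ0.le h7
  have hb := abs_bracket_two_le hX hY hZ
  have e1 : aTwo H ρ = -(24 / 7) / ρ ^ 12 * (ρ ^ 6 * deriv H ρ * (ρ ^ 7 * deriv (deriv H) ρ)
      - 3 * (ρ ^ 5 * H ρ) * (ρ ^ 7 * deriv (deriv H) ρ) - 2 * (ρ ^ 6 * deriv H ρ) ^ 2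
      - 18 * (ρ ^ 5 * H ρ) * (ρ ^ 6 * deriv H ρ)) := by
    unfold aTwo
    field_simp
  rw [e1, abs_mul, abs_div, abs_neg, abs_of_pos (by norm_num : (0:ℝ) < 24 / 7), abs_of_pos (pow_pos hρ0 12)]
  rw [div_mul_eq_mul_div]
  exact div_le_div_of_nonneg_right (by nlinarith [hb, abs_nonneg (ρ ^ 6 * deriv H ρ * (ρ ^ 7 * deriv (deriv H) ρ)
      - 3 * (ρ ^ 5 * H ρ) * (ρ ^ 7 * deriv (deriv H) ρ) - 2 * (ρ ^ 6 * deriv H ρ) ^ 2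
      - 18 * (ρ ^ 5 * H ρ) * (ρ ^ 6 * deriv H ρ))]) (pow_nonneg hρ0.le 12)

/-- `|a₄(ρ)| ≤ 152 C²/ρ¹⁴` for `ρ ≥ 1`. -/
theorem abs_aFour_le (hC : ∀ r, 1 ≤ r → r ^ 5 * |H r| ≤ C ∧ r ^ 6 * |deriv H r| ≤ C ∧ r ^ 7 * |deriv (deriv H) r| ≤ C)
    {ρ : ℝ} (hρ : 1 ≤ ρ) : |aFour H ρ| ≤ 152 * C ^ 2 / ρ ^ 14 := by
  have hρ0 : 0 < ρ := lt_of_lt_of_le one_pos hρ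
  obtain ⟨h5, h6, h7⟩ := hC ρ hρ
  have hX := abs_pow_mul_le hρ0.le h5
  have hY := abs_pow_mul_le hρ0.le h6
  have hZ := abs_pow_mul_le hρ0.le h7
  have hb := abs_bracket_four_le hX hY hZ
  have e1 : aFour H ρ = 8 / ρ ^ 14 * (ρ ^ 6 * deriv H ρ * (ρ ^ 7 * deriv (deriv H) ρ)
      - 3 * (ρ ^ 5 * H ρ) * (ρ ^ 7 * deriv (deriv H) ρ) + 12 * (ρ ^ 6 * deriv H ρ) ^ 2
      + 3 * (ρ ^ 5 * H ρ) * (ρ ^ 6 * deriv H ρ)) := by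
    unfold aFour
    field_simp
  rw [e1, abs_mul, abs_div, abs_of_pos (by norm_num : (0:ℝ) < 8), abs_of_pos (pow_pos hρ0 14)]
  rw [div_mul_eq_mul_div]
  exact div_le_div_of_nonneg_right (by nlinarith [hb, abs_nonneg (ρ ^ 6 * deriv H ρ * (ρ ^ 7 * deriv (deriv H) ρ)
      - 3 * (ρ ^ 5 * H ρ) * (ρ ^ 7 * deriv (deriv H) ρ) + 12 * (ρ ^ 6 * deriv H ρ) ^ 2
      + 3 * (ρ ^ 5 * H ρ) * (ρ ^ 6 * deriv H ρ))]) (pow_nonneg hρ0.le 14)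

/-- an algebraic squeeze for the monopole: `|36X² + (216/5)XY + (4/5)Y² + (24/5)XZ − (8/5)YZ| ≤ (432/5) C²`. -/
theorem abs_bracket_zero_le {X Y Z C : ℝ} (hX : |X| ≤ C) (hY : |Y| ≤ C) (hZ : |Z| ≤ C) :
    |36 * X ^ 2 + 216 / 5 * X * Y + 4 / 5 * Y ^ 2 + 24 / 5 * X * Z - 8 / 5 * Y * Z| ≤ 432 / 5 * C ^ 2 := by
  have hC0 : 0 ≤ C := (abs_nonneg X).trans hX
  have hXX : |X * X| ≤ C * C := by rw [abs_mul]; exact mul_le_mul hX hX (abs_nonneg _) hC0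
  have hXY : |X * Y| ≤ C * C := by rw [abs_mul]; exact mul_le_mul hX hY (abs_nonneg _) hC0
  have hYY : |Y * Y| ≤ C * C := by rw [abs_mul]; exact mul_le_mul hY hY (abs_nonneg _) hC0
  have hXZ : |X * Z| ≤ C * C := by rw [abs_mul]; exact mul_le_mul hX hZ (abs_nonneg _) hC0
  have hYZ : |Y * Z| ≤ C * C := by rw [abs_mul]; exact mul_le_mul hY hZ (abs_nonneg _) hC0
  rw [abs_le] at hXX hXY hYY hXZ hYZ ⊢
  constructor <;> nlinarith [hXX.1, hXX.2, hXY.1, hXY.2, hYY.1, hYY.2, hXZ.1, hXZ.2, hYZ.1, hYZ.2]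

/-- decay of `ã₂`: `|chanTwo h σ| ≤ (576/7)C²/σ⁴` for `σ ≥ 1`. -/
theorem abs_chanTwo_le (hh : ContDiff ℝ ∞ h) (hH : ∀ r, 0 ≤ r → H r = h (r ^ 2))
    (hC : ∀ r, 1 ≤ r → r ^ 5 * |H r| ≤ C ∧ r ^ 6 * |deriv H r| ≤ C ∧ r ^ 7 * |deriv (deriv H) r| ≤ C)
    {σ : ℝ} (hσ : 1 ≤ σ) : |chanTwo h σ| ≤ (576 / 7 * C ^ 2) / σ ^ (2 + 2) := by
  have hσ0 : 0 < σ := by linarith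
  set ρ := Real.sqrt σ with hρ
  have hρ1 : 1 ≤ ρ := by rw [hρ, ← Real.sqrt_one]; exact Real.sqrt_le_sqrt hσ
  have hρ0 : 0 < ρ := by linarith
  have hρσ : ρ ^ 2 = σ := Real.sq_sqrt hσ0.le
  have hC0 : 0 ≤ C := decay_const_nonneg hC
  rw [← hρσ, chanTwo_sq_eq hh hH hρ0]
  refine (abs_aTwo_le hC hρ1).trans ?_
  rw [← pow_mul]
  exact div_le_div_of_nonneg_left (by positivity) (by positivity) (pow_le_pow_right₀ hρ1 (by norm_num))

/-- decay of `ã₄`: `|chanFour h σ| ≤ 152C²/σ⁶` for `σ ≥ 1`. -/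
theorem abs_chanFour_le (hh : ContDiff ℝ ∞ h) (hH : ∀ r, 0 ≤ r → H r = h (r ^ 2))
    (hC : ∀ r, 1 ≤ r → r ^ 5 * |H r| ≤ C ∧ r ^ 6 * |deriv H r| ≤ C ∧ r ^ 7 * |deriv (deriv H) r| ≤ C)
    {σ : ℝ} (hσ : 1 ≤ σ) : |chanFour h σ| ≤ (152 * C ^ 2) / σ ^ (4 + 2) := by
  have hσ0 : 0 < σ := by linarith
  set ρ := Real.sqrt σ with hρ
  have hρ1 : 1 ≤ ρ := by rw [hρ, ← Real.sqrt_one]; exact Real.sqrt_le_sqrt hσ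
  have hρ0 : 0 < ρ := by linarith
  have hρσ : ρ ^ 2 = σ := Real.sq_sqrt hσ0.le
  have hC0 : 0 ≤ C := decay_const_nonneg hC
  rw [← hρσ, chanFour_sq_eq hh hH hρ0]
  refine (abs_aFour_le hC hρ1).trans ?_
  rw [← pow_mul]
  exact div_le_div_of_nonneg_left (by positivity) (by positivity) (pow_le_pow_right₀ hρ1 (by norm_num))

/-- decay of `ã₀`: `|chanZero h σ| ≤ (432/5)C²/σ²` for `σ ≥ 1`. -/
theorem abs_chanZero_le (hh : ContDiff ℝ ∞ h) (hH : ∀ r, 0 ≤ r → H r = h (r ^ 2))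
    (hC : ∀ r, 1 ≤ r → r ^ 5 * |H r| ≤ C ∧ r ^ 6 * |deriv H r| ≤ C ∧ r ^ 7 * |deriv (deriv H) r| ≤ C)
    {σ : ℝ} (hσ : 1 ≤ σ) : |chanZero h σ| ≤ (432 / 5 * C ^ 2) / σ ^ (0 + 2) := by
  have hσ0 : 0 < σ := by linarith
  set ρ := Real.sqrt σ with hρ
  have hρ1 : 1 ≤ ρ := by rw [hρ, ← Real.sqrt_one]; exact Real.sqrt_le_sqrt hσ
  have hρ0 : 0 < ρ := by linarith
  have hρσ : ρ ^ 2 = σ := Real.sq_sqrt hσ0.le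
  have hC0 : 0 ≤ C := decay_const_nonneg hC
  obtain ⟨h5, h6, h7⟩ := hC ρ hρ1
  have hX := abs_pow_mul_le hρ0.le h5
  have hY := abs_pow_mul_le hρ0.le h6
  have hZ := abs_pow_mul_le hρ0.le h7
  have hb := abs_bracket_zero_le hX hY hZ
  rw [← hρσ, chanZero_sq_eq hh hH hρ0]
  have e1 : 36 * H ρ ^ 2 + 216 / 5 * ρ * H ρ * deriv H ρ + 4 / 5 * ρ ^ 2 * deriv H ρ ^ 2
      + 24 / 5 * ρ ^ 2 * H ρ * deriv (deriv H) ρ - 8 / 5 * ρ ^ 3 * deriv H ρ * deriv (deriv H) ρ =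
      (ρ ^ 10)⁻¹ * (36 * (ρ ^ 5 * H ρ) ^ 2 + 216 / 5 * (ρ ^ 5 * H ρ) * (ρ ^ 6 * deriv H ρ) + 4 / 5 * (ρ ^ 6 * deriv H ρ) ^ 2
        + 24 / 5 * (ρ ^ 5 * H ρ) * (ρ ^ 7 * deriv (deriv H) ρ) - 8 / 5 * (ρ ^ 6 * deriv H ρ) * (ρ ^ 7 * deriv (deriv H) ρ)) := by
    field_simp
  rw [e1, abs_mul, abs_inv, abs_of_pos (pow_pos hρ0 10), ← pow_mul, inv_mul_eq_div]
  calc _ ≤ (432 / 5 * C ^ 2) / ρ ^ 10 := div_le_div_of_nonneg_right hb (pow_nonneg hρ0.le 10)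
    _ ≤ (432 / 5 * C ^ 2) / ρ ^ (2 * (0 + 2)) :=
        div_le_div_of_nonneg_left (by positivity) (by positivity) (pow_le_pow_right₀ hρ1 (by norm_num))

end Summit.NavierStokesRegularity.NavierStokesRegularity.Theorems.UnthreadedRigidity.HornPressure

end
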